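import Summits.QuantumFields.BalabanUV.T4Continuum.Support.SubstrateRawSpecies
import Summits.QuantumFields.BalabanUV.T4Continuum.Support.SubstrateActivities
import Summits.QuantumFields.BalabanUV.T4Continuum.Support.SubstrateGaussianLetters
import Summits.QuantumFields.BalabanUV.T4Continuum.Support.U3PolymerDictionaryNE9FaceD6

/-!
# SUBSTRATE — THE `Slots` OF RECORD on the two-run object (MAP §O1 O-8): `act := actOfLetters ℓ` with p3's Gaussian letters `gaussN ∕ gaussQ ∘
# linForm`, `F k := (W k).format`, `rawA ∕ rawB :=` the kernels of the raw species of record, an insertion-operator datum reading ONLY the last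
# coupling BY CONSTRUCTION — the two `LastCouplingOnly` lines NE9's D-6 face consumes, hence NE9's outer binder `Factorises` AT THE BACKGROUND SLOT
# for NE5's functional of record `outB_KP (slotsOfRecord …)`, every window (MAP §O1 O-2∕O-3′∕O-8, [dict] D-6∕D-6′; typer NEXT v0.4 (2))

Cell `pub-balaban`, SUBSTRATE cell, seat `b2b-balaban-substrate-p1` («instances first»).  Summits-side under the LEAN PLACEMENT RULE.  HONEST
FRAMING: rung (B)+1 of the FINITE-VOLUME T⁴ programme — NOT infinite volume, NOT a mass gap, NOT Clay; spine PROVED 0∕9; NE5∕NE9 NOT proved.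
CONSTRUCTED HERE (O-8): the entry type `SpeciesRec` (κ := unit-lattice vector-colour index `(Tor (unitMod P) × Fin d) × o`, O-3′ RIDER); `act :=
SubstrateActivities.actOfLetters ℓ` (p219669) with `ℓ.N := gaussN (linForm base rd)`, `ℓ.q := gaussQ (linForm base rd) coords` (p3's
`SubstrateGaussianLetters`, p219426); `F k := (W k).format`; `rawA ∕ rawB g U k := (rawA∕BOfRecord … g U k).kernel` (p219509); `D.insOpA ∕ insOpB
g U k := iop (g (k − 1)) U k` (reading (α), D-6′).  DISPLAYED AS NAMED PARAMETERS (NE5's calibration ∕ physics letters, NOT the substrate's to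
choose): the frame `P : MeasPotFrame`, the weight family `W : ℕ → B13Weights`, the factor letters `κ₁, r, cons, nsign, B` and the Gaussian
tables `base, rd, coords` per factor `(Z, j)` (`ActLetters`), the insertion core `base ∕ slice ∕ ω` and the tables `iop` (`InsLetters`), the
margins `rOp ∕ rHist`, the contour systems and the kernel∕potential tables `dk, gc, pQ, pR` of both runs.  Nothing printed is asserted; no estimate.
HONEST DEPENDENCY (cell line, verbatim): continuum YM on T⁴ ⇐ BetaPertH ∧ nine spine estimates (0/9 proved); BetaPertH ⇐ (D1) ∧ (D4) ∧
CAP+tail; G-an2-4 gates asym, D1 and NE2/3/4.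

WHAT.
* §1 `InsLetters` + **`insDatumOfRecord D L : InsDatum D.carriers IOp Hist`** ⇒ **`lastCouplingOnly_insOpB ∕ _insOpA`** (`simp`).
* §2 `ActLetters` + **`coreLettersOf`** (the `CoreLetters` with Gaussian letters `gaussN ∕ gaussQ ∘ linForm`; `coreLettersOf_N ∕ _q` `rfl`).
* §3 `SlotLetters` + **`slotsOfRecord D ι c a s P L : Slots D.toTwoRuns (SpeciesRec D o T ι′ Ω 𝒴) IOp (B13HistM P)`**; `rfl` views
  `slotsOfRecord_act ∕ _F ∕ _rawA ∕ _rawB ∕ _D`; **`lastCouplingOnly_slots_rawB ∕ _rawA ∕ _insOpB`** and the unfolded forms `slots_hraw ∕ slots_hiop`.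
* §4 **`factorises_outB_KP_slotsOfRecord`**: `T4HistoryLipschitzOuter.Factorises` for `outB_KP (slotsOfRecord …) E₀ cB` at the background slot on
  EVERY window — the NE9 owner's `factorises_outB_KP_of_lastCoupling` BY NAME on §3's two lines (a structural binder inhabited; nothing of NE9's estimate).
* §5 (v1.1, APPEND-ONLY; typer RULING (2) l.15094 = F-ne5leaf01g11-1 repair (a′), sketch v0.6 §IOP verbatim): **`InsLetters.ofAt`** — run A's
  insertion-operator table typed on RUN-A backgrounds and READ AT THE TRANSPORTED background (O-8 as intended, «run A's through the transporter
  exactly as `rawAOfRecord`»), `iopA_ofAt ∕ iopB_ofAt` (rfl), `lastCouplingOnly_insOpA_ofAt`, `SlotLetters.ofAt`, and **`transportReads_slotsOfRecord_ofAt`**: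
  NE5 L01's `(assembly (slotsOfRecord … (L.ofAt iopAt))).TransportReads W` BY CONSTRUCTION (O1-e's `Assembly.transportReads_of_insOpAt` with `h := rfl`).
Imports p219509, p219669, p219426 and the NE9 owner's D-6 face; nothing existing is modified.
-/

noncomputable section

open scoped BigOperators
open _root_.MeasureTheory

namespace Summit.QuantumFields.BalabanUV.T4Continuum.SubstrateSlotsOfRecord

open Literature.MathematicalPhysics.QuantumFieldTheory.Balaban1983to89
open Literature.MathematicalPhysics.QuantumFieldTheory.Balaban1983to89.T4OutputRate (Carriers Functional)
open Literature.MathematicalPhysics.QuantumFieldTheory.Balaban1983to89.T4HistoryLipschitzOuter (Factorises)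
open Literature.MathematicalPhysics.QuantumFieldTheory.Balaban1983to89.B5Prop11Plancherel (Tor)
open Literature.MathematicalPhysics.QuantumFieldTheory.Balaban1983to89.B5G183RateUnitTower (lev)
open Summit.QuantumFields.BalabanUV.T4Continuum.CovariantBlockAveraging (ContourSystem)
open Summit.QuantumFields.BalabanUV.T4Continuum.B13Carriers (TwoRuns)
open Summit.QuantumFields.BalabanUV.T4Continuum.B13CarriersCubeChart (cubeChart)
open Summit.QuantumFields.BalabanUV.T4Continuum.B13OpDatum (Format Species RawSpecies OpDatum B13Weights)
open Summit.QuantumFields.BalabanUV.T4Continuum.B13HistMeasurable (MeasPotFrame B13HistM)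
open Summit.QuantumFields.BalabanUV.T4Continuum.B13HistInsertion (InsDatum)
open Summit.QuantumFields.BalabanUV.T4Continuum.B13StepTermLabels (InnerLabel)
open Summit.QuantumFields.BalabanUV.T4Continuum.B13InnerData (Bnd)
open Summit.QuantumFields.BalabanUV.T4Continuum.B13StepOfRecord (Slots)
open Summit.QuantumFields.BalabanUV.T4Continuum.B13KPStepOfRecord (outB_KP)
open Summit.QuantumFields.BalabanUV.T4Continuum.U3PolymerDictionaryNE9Face (actNE9 oRecLast iRecLast
  factorises_outB_KP_of_lastCoupling)
open Summit.QuantumFields.BalabanUV.T4Continuum.SubstrateBackgroundTransporters (unitMod)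
open Summit.QuantumFields.BalabanUV.T4Continuum.SubstrateTwoRunsDriven (DrivenRuns)
open Summit.QuantumFields.BalabanUV.T4Continuum.SubstrateRawSpecies
open Summit.QuantumFields.BalabanUV.T4Continuum.SubstrateActivities (CoreLetters actOfLetters)
open Summit.QuantumFields.BalabanUV.T4Continuum.SubstrateGaussianLetters (gaussN gaussQ linForm)

variable {G : Type} [GaugeGroup G] (D : DrivenRuns G)

/-! ## §1 The insertion datum of record: insertion operators read at the LAST coupling -/

/-- [folklore] LETTERS of the insertion datum (NE5 O1-c's `InsDatum` core `base ∕ slice ∕ ω`, displayed; the two runs' insertion-operator tables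
`iopA ∕ iopB` as functions of the LAST COUPLING, the background and the level — reading (α)). -/
structure InsLetters (IOp Hist : Type*) [NormedAddCommGroup Hist] [NormedSpace ℂ Hist] where
  /-- table-independent part -/
  base : ℕ → IOp → Hist
  /-- age-free single-scale insertion operators -/
  slice : ℕ → ℕ → IOp → (D.carriers.Dom → ℝ) → Hist
  slice_add : ∀ k j a t t', slice k j a (t + t') = slice k j a t + slice k j a t'
  slice_smul : ∀ k j a (r : ℝ) t, slice k j a (r • t) = (r : ℂ) • slice k j a t
  slice_local : ∀ k j a t t', (∀ Y, D.carriers.scale Y = j → t Y = t' Y) → slice k j a t = slice k j a t'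
  /-- age damping per unit of age -/
  ω : ℝ
  /-- run A's insertion-operator table at (last coupling, transported background, level) — a `BgB`-typed table is the GENERAL letter; the
  reading of record (O-8: run A's table on RUN-A backgrounds read at the TRANSPORTED background) is `InsLetters.ofAt` (§5, v1.1) -/
  iopA : ℝ → D.carriers.BgB → ℕ → IOp
  /-- run B's insertion-operator table at (last coupling, background, level) -/
  iopB : ℝ → D.carriers.BgB → ℕ → IOp

section Ins

variable {IOp Hist : Type*} [NormedAddCommGroup Hist] [NormedSpace ℂ Hist]

/-- [folklore] **THE INSERTION DATUM OF RECORD**: `insOpA ∕ insOpB g U k := iop (g (k − 1)) U k` — at output level `k` the insertion operators read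
the coupling sequence ONLY at the last coupling `g (k − 1)` (D-6′); the core `base ∕ slice ∕ ω` is the displayed one. -/
def insDatumOfRecord (L : InsLetters D IOp Hist) : InsDatum D.carriers IOp Hist where
  base := L.base
  slice := L.slice
  slice_add := L.slice_add
  slice_smul := L.slice_smul
  slice_local := L.slice_local
  ω := L.ω
  insOpA := fun g U k => L.iopA (g (k - 1)) U k
  insOpB := fun g U k => L.iopB (g (k - 1)) U k

/-- [folklore] **D-6′ BY CONSTRUCTION, run B**: the insertion-operator datum of record reads only the last coupling. -/
theorem lastCouplingOnly_insOpB (L : InsLetters D IOp Hist) : LastCouplingOnly (insDatumOfRecord D L).insOpB := by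
  intro g g' U k hg
  simp only [insDatumOfRecord, Nat.add_sub_cancel, hg]

/-- [folklore] D-6′ by construction, run A. -/
theorem lastCouplingOnly_insOpA (L : InsLetters D IOp Hist) : LastCouplingOnly (insDatumOfRecord D L).insOpA := by
  intro g g' U k hg
  simp only [insDatumOfRecord, Nat.add_sub_cancel, hg]

end Ins

/-! ## §2 The factor letters with p3's Gaussian letters plugged -/

/-- [folklore] The species entry type of record: NE5's `Species` with covariance index the unit-lattice vector-colour index of run A's torus
(definitionally the same for run B's: both unit tori have `2·L^m` sites per direction, `T4Family.P_L ∕ P_m ∕ P_d` are `rfl`). -/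
abbrev SpeciesRec (D : DrivenRuns G) (o T ι' Ω 𝒴 : Type) : Type :=
  Species T ((Tor (unitMod (D.F.P D.K)) × Fin (D.F.P D.K).d) × o) ι' Ω 𝒴

section Act

variable (P : MeasPotFrame D.carriers) (Op : Type) [NormedAddCommGroup Op] [NormedSpace ℂ Op] {J : Type}
  (𝒵 : D.carriers.Dom → J → Type) [∀ Z j, Fintype (𝒵 Z j)] (dom : ∀ Z j, 𝒵 Z j → D.carriers.Dom)
  (Jc : D.carriers.Dom → J → Type) [∀ Z j, Fintype (Jc Z j)]
  (V : D.carriers.Dom → J → Type) [∀ Z j, NormedAddCommGroup (V Z j)] [∀ Z j, InnerProductSpace ℝ (V Z j)]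
  [∀ Z j, MeasurableSpace (V Z j)] [∀ Z j, BorelSpace (V Z j)] [∀ Z j, FiniteDimensional ℝ (V Z j)]
  (mI : D.carriers.Dom → J → Type) [∀ Z j, Fintype (mI Z j)] [∀ Z j, DecidableEq (mI Z j)]

/-- [folklore] LETTERS of ONE factor `(Z, j)` (displayed): `CoreLetters` minus the two Gaussian letters, plus the Gaussian TABLES `base, rd` of the
flat-coordinate quadratic form (p3's `linForm`) and the flat coordinates `coords`. -/
structure ActLetters (Z : D.carriers.Dom) (j : J) where
  /-- cube-contour letter -/
  κ₁ : ℝ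
  κ₁_pos : 0 < κ₁
  /-- (2.18) radii -/
  r : 𝒵 Z j → ℝ
  one_lt_r : ∀ Y, 1 < r Y
  /-- χ-constraints -/
  cons : List ((V Z j →L[ℝ] ℝ) × ℝ × Bool)
  /-- sign exponent -/
  nsign : ℕ
  /-- field maps into the frame -/
  B : (Y : 𝒵 Z j) → V Z j → P.Arg (dom Z j Y)
  measB : ∀ Y, Measurable (B Y)
  /-- operator-independent part of the quadratic form, per contour parameter -/
  base : ((Jc Z j ⊕ 𝒵 Z j) → ℝ × ℝ) → Matrix (mI Z j) (mI Z j) ℂ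
  /-- its linear read-outs of the operator datum -/
  rd : ((Jc Z j ⊕ 𝒵 Z j) → ℝ × ℝ) → mI Z j → mI Z j → (Op →L[ℂ] ℂ)
  /-- flat coordinates of the fluctuation variable -/
  coords : V Z j →ₗᵢ[ℝ] EuclideanSpace ℝ (mI Z j)

/-- [folklore] **THE CORE LETTERS OF RECORD**: `N := gaussN (linForm base rd)`, `q := gaussQ (linForm base rd) coords` (p3, p219426), the rest displayed. -/
def coreLettersOf (A : ∀ Z j, ActLetters D P Op 𝒵 dom Jc V mI Z j) (Z : D.carriers.Dom) (j : J) : CoreLetters P Op 𝒵 dom Jc V Z j where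
  κ₁ := (A Z j).κ₁
  κ₁_pos := (A Z j).κ₁_pos
  r := (A Z j).r
  one_lt_r := (A Z j).one_lt_r
  N := gaussN (linForm (A Z j).base (A Z j).rd)
  q := gaussQ (linForm (A Z j).base (A Z j).rd) (A Z j).coords
  cons := (A Z j).cons
  nsign := (A Z j).nsign
  B := (A Z j).B
  measB := (A Z j).measB

omit [∀ Z j, Fintype (𝒵 Z j)] [∀ Z j, Fintype (Jc Z j)] [∀ Z j, BorelSpace (V Z j)] [∀ Z j, FiniteDimensional ℝ (V Z j)] in
/-- [folklore] The normalisation letter of record IS p3's `gaussN ∘ linForm`. -/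
theorem coreLettersOf_N (A : ∀ Z j, ActLetters D P Op 𝒵 dom Jc V mI Z j) (Z : D.carriers.Dom) (j : J) :
    (coreLettersOf D P Op 𝒵 dom Jc V mI A Z j).N = gaussN (linForm (A Z j).base (A Z j).rd) := rfl

omit [∀ Z j, Fintype (𝒵 Z j)] [∀ Z j, Fintype (Jc Z j)] [∀ Z j, BorelSpace (V Z j)] [∀ Z j, FiniteDimensional ℝ (V Z j)] in
/-- [folklore] The quadratic-form letter of record IS p3's `gaussQ ∘ linForm`. -/
theorem coreLettersOf_q (A : ∀ Z j, ActLetters D P Op 𝒵 dom Jc V mI Z j) (Z : D.carriers.Dom) (j : J) :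
    (coreLettersOf D P Op 𝒵 dom Jc V mI A Z j).q = gaussQ (linForm (A Z j).base (A Z j).rd) (A Z j).coords := rfl

end Act

/-! ## §3 The `Slots` of record -/

section SlotsRecord

variable {o : Type} [Fintype o] [DecidableEq o] (ι : G →* Matrix o o ℂ) (c : ℂ) (a : ℝ) (s : ℕ → ℂ)
variable {T ι' S Ω 𝒴 : Type} (P : MeasPotFrame D.carriers) {IOp : Type*}
  (𝒵 : D.carriers.Dom → InnerLabel D.carriers.Dom (Bnd D.toTwoRuns) → Type) [∀ Z j, Fintype (𝒵 Z j)] (dom : ∀ Z j, 𝒵 Z j → D.carriers.Dom)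
  (Jc : D.carriers.Dom → InnerLabel D.carriers.Dom (Bnd D.toTwoRuns) → Type) [∀ Z j, Fintype (Jc Z j)]
  (V : D.carriers.Dom → InnerLabel D.carriers.Dom (Bnd D.toTwoRuns) → Type) [∀ Z j, NormedAddCommGroup (V Z j)]
  [∀ Z j, InnerProductSpace ℝ (V Z j)] [∀ Z j, MeasurableSpace (V Z j)] [∀ Z j, BorelSpace (V Z j)] [∀ Z j, FiniteDimensional ℝ (V Z j)]
  (mI : D.carriers.Dom → InnerLabel D.carriers.Dom (Bnd D.toTwoRuns) → Type) [∀ Z j, Fintype (mI Z j)] [∀ Z j, DecidableEq (mI Z j)]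

/-- [folklore] THE LETTERS of the `Slots` of record (displayed): the factor letters, the weight family, the two runs' contour systems and
kernel∕potential tables of the non-covariance species, the insertion letters, the margins. -/
structure SlotLetters where
  /-- factor letters per `(Z, j)` -/
  A : ∀ Z j, ActLetters D P (OpDatum (SpeciesRec D o T ι' Ω 𝒴)) 𝒵 dom Jc V mI Z j
  /-- the weight family (formats `F k := (W k).format`) -/
  W : ℕ → B13Weights ((Tor (unitMod (D.F.P D.K)) × Fin (D.F.P D.K).d) × o) ι' S 𝒴
  /-- run A's contour systems per NE2 level -/
  ΓA : (k : ℕ) → ContourSystem (D.F.P D.K).d (lev (D.F.P D.K).L k) (unitMod (D.F.P D.K))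
  /-- run B's -/
  ΓB : (k : ℕ) → ContourSystem (D.F.P (D.K + 1)).d (lev (D.F.P (D.K + 1)).L k) (unitMod (D.F.P (D.K + 1)))
  /-- run A's kernel∕potential tables of the non-covariance species -/
  dkA : GaugeField (D.F.P D.K) 0 G → ℕ → T → ι' → ι' → ℂ
  gcA : GaugeField (D.F.P D.K) 0 G → ℕ → T → ((Tor (unitMod (D.F.P D.K)) × Fin (D.F.P D.K).d) × o) → ι' → ℂ
  pQA : ℝ → GaugeField (D.F.P D.K) 0 G → ℕ → Ω → 𝒴 → ((Tor (unitMod (D.F.P D.K)) × Fin (D.F.P D.K).d) × o) →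
    ((Tor (unitMod (D.F.P D.K)) × Fin (D.F.P D.K).d) × o) → ℂ
  pRA : ℝ → GaugeField (D.F.P D.K) 0 G → ℕ → Ω → 𝒴 → ℂ
  /-- run B's -/
  dkB : GaugeField (D.F.P (D.K + 1)) 0 G → ℕ → T → ι' → ι' → ℂ
  gcB : GaugeField (D.F.P (D.K + 1)) 0 G → ℕ → T → ((Tor (unitMod (D.F.P (D.K + 1))) × Fin (D.F.P (D.K + 1)).d) × o) → ι' → ℂ
  pQB : ℝ → GaugeField (D.F.P (D.K + 1)) 0 G → ℕ → Ω → 𝒴 → ((Tor (unitMod (D.F.P (D.K + 1))) × Fin (D.F.P (D.K + 1)).d) × o) →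
    ((Tor (unitMod (D.F.P (D.K + 1))) × Fin (D.F.P (D.K + 1)).d) × o) → ℂ
  pRB : ℝ → GaugeField (D.F.P (D.K + 1)) 0 G → ℕ → Ω → 𝒴 → ℂ
  /-- insertion letters -/
  ins : InsLetters D IOp (B13HistM P)
  /-- margins (NE5 R33 ∕ R35) -/
  rOp : ℕ → ℝ
  rHist : ℕ → ℝ
  rOp_pos : ∀ k, 0 < rOp k
  rHist_pos : ∀ k, 0 < rHist k

variable (L : SlotLetters D (o := o) (T := T) (ι' := ι') (S := S) (Ω := Ω) (𝒴 := 𝒴) P (IOp := IOp) 𝒵 dom Jc V mI)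

/-- [folklore] **THE `Slots` OF RECORD** on the two-run object `D` (O-8): `act := actOfLetters (coreLettersOf A)`, `F k := (W k).format`, the
covariance species of both runs = the V1 operator entries of `SubstrateRawSpecies` (run A on torus `K` with `D.avA`, run B on torus `K + 1` with
`D.avB`), `D := insDatumOfRecord`, margins displayed. -/
def slotsOfRecord : Slots D.toTwoRuns (SpeciesRec D o T ι' Ω 𝒴) IOp (B13HistM P) where
  act := actOfLetters P (OpDatum (SpeciesRec D o T ι' Ω 𝒴)) 𝒵 dom Jc V (coreLettersOf D P _ 𝒵 dom Jc V mI L.A)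
  F := fun k => (L.W k).format
  rawA := fun g U k => (rawAOfRecord ι D c a s L.ΓA L.dkA L.gcA L.pQA L.pRA g U k).kernel
  rawB := fun g U k => (rawBOfRecord ι D c a s L.ΓB L.dkB L.gcB L.pQB L.pRB g U k).kernel
  D := insDatumOfRecord D L.ins
  rOp := L.rOp
  rHist := L.rHist
  rOp_pos := L.rOp_pos
  rHist_pos := L.rHist_pos

/-- [folklore] The `act` slot IS `actOfLetters` of the core letters of record (`rfl`). -/
theorem slotsOfRecord_act : (slotsOfRecord D ι c a s P 𝒵 dom Jc V mI L).act =
    actOfLetters P (OpDatum (SpeciesRec D o T ι' Ω 𝒴)) 𝒵 dom Jc V (coreLettersOf D P _ 𝒵 dom Jc V mI L.A) := rfl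

/-- [folklore] The formats ARE the B13 formats of the weights: the census chain's `hF` shape (`rfl`). -/
theorem slotsOfRecord_F (k : ℕ) : (slotsOfRecord D ι c a s P 𝒵 dom Jc V mI L).F k = (L.W k).format := rfl

/-- [folklore] Run A's raw species slot IS the kernel of `rawAOfRecord` (`rfl`). -/
theorem slotsOfRecord_rawA (g : ℕ → ℝ) (U : D.carriers.BgA) (k : ℕ) : (slotsOfRecord D ι c a s P 𝒵 dom Jc V mI L).rawA g U k =
    (rawAOfRecord ι D c a s L.ΓA L.dkA L.gcA L.pQA L.pRA g U k).kernel := rfl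

/-- [folklore] Run B's raw species slot IS the kernel of `rawBOfRecord` (`rfl`). -/
theorem slotsOfRecord_rawB (g : ℕ → ℝ) (U : D.carriers.BgB) (k : ℕ) : (slotsOfRecord D ι c a s P 𝒵 dom Jc V mI L).rawB g U k =
    (rawBOfRecord ι D c a s L.ΓB L.dkB L.gcB L.pQB L.pRB g U k).kernel := rfl

/-- [folklore] The insertion datum IS `insDatumOfRecord` (`rfl`). -/
theorem slotsOfRecord_D : (slotsOfRecord D ι c a s P 𝒵 dom Jc V mI L).D = insDatumOfRecord D L.ins := rfl

/-- [folklore] **D-6 FOR THE SLOTS OF RECORD, run B's raw species**: `LastCouplingOnly (slotsOfRecord …).rawB` (`lastCouplingOnly_rawBOfRecord`). -/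
theorem lastCouplingOnly_slots_rawB : LastCouplingOnly (slotsOfRecord D ι c a s P 𝒵 dom Jc V mI L).rawB := by
  intro g g' U k hg
  rw [slotsOfRecord_rawB, slotsOfRecord_rawB, lastCouplingOnly_rawBOfRecord ι D c a s L.ΓB L.dkB L.gcB L.pQB L.pRB g g' U k hg]

/-- [folklore] The same for run A. -/
theorem lastCouplingOnly_slots_rawA : LastCouplingOnly (slotsOfRecord D ι c a s P 𝒵 dom Jc V mI L).rawA := by
  intro g g' U k hg
  rw [slotsOfRecord_rawA, slotsOfRecord_rawA, lastCouplingOnly_rawAOfRecord ι D c a s L.ΓA L.dkA L.gcA L.pQA L.pRA g g' U k hg]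

/-- [folklore] **D-6′ FOR THE SLOTS OF RECORD**: `LastCouplingOnly (slotsOfRecord …).D.insOpB`. -/
theorem lastCouplingOnly_slots_insOpB : LastCouplingOnly (slotsOfRecord D ι c a s P 𝒵 dom Jc V mI L).D.insOpB :=
  lastCouplingOnly_insOpB D L.ins

/-- [folklore] The hypothesis `hraw` of the D-6 face `factorises_outB_KP_of_lastCoupling`, for the slots of record (unfolded form). -/
theorem slots_hraw : ∀ (g g' : ℕ → ℝ) (U : D.carriers.BgB) (k : ℕ), g k = g' k →
    (slotsOfRecord D ι c a s P 𝒵 dom Jc V mI L).rawB g U (k + 1) = (slotsOfRecord D ι c a s P 𝒵 dom Jc V mI L).rawB g' U (k + 1) :=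
  lastCouplingOnly_slots_rawB D ι c a s P 𝒵 dom Jc V mI L

/-- [folklore] The hypothesis `hiop` of the D-6 face, for the slots of record. -/
theorem slots_hiop : ∀ (g g' : ℕ → ℝ) (U : D.carriers.BgB) (k : ℕ), g k = g' k →
    (slotsOfRecord D ι c a s P 𝒵 dom Jc V mI L).D.insOpB g U (k + 1) =
      (slotsOfRecord D ι c a s P 𝒵 dom Jc V mI L).D.insOpB g' U (k + 1) :=
  lastCouplingOnly_slots_insOpB D ι c a s P 𝒵 dom Jc V mI L

/-! ## §4 NE9's outer binder at the background slot, for NE5's functional of record on the slots of record — by name -/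

/-- [folklore] **`Factorises` FOR `outB_KP (slotsOfRecord …) E₀ cB` AT THE BACKGROUND SLOT, EVERY WINDOW** — the NE9 owner's D-6 face
`factorises_outB_KP_of_lastCoupling` applied to §3's two last-coupling lines; the `g`-independent channel is «the earlier table itself», the
new-term map reads through `actNE9 S (oRecLast S) (iRecLast S)`.  A structural binder inhabited by construction; nothing of NE9's estimate. -/
theorem factorises_outB_KP_slotsOfRecord (E₀ cB : ℝ) (W : Set (ℕ → ℝ)) :
    Factorises (C := D.carriers) (ι := D.carriers.BgB × D.carriers.Dom) (outB_KP (slotsOfRecord D ι c a s P 𝒵 dom Jc V mI L) E₀ cB) W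
      (fun _ _ H p => H p.1 p.2)
      fun k σ Q U X => ((cubeChart D.toTwoRuns).geom.newTerm
        (actNE9 (slotsOfRecord D ι c a s P 𝒵 dom Jc V mI L) (oRecLast (slotsOfRecord D ι c a s P 𝒵 dom Jc V mI L))
          (iRecLast (slotsOfRecord D ι c a s P 𝒵 dom Jc V mI L)))
        k σ U X (fun Y => Q (U, Y))).re :=
  factorises_outB_KP_of_lastCoupling _ E₀ cB W (slots_hraw D ι c a s P 𝒵 dom Jc V mI L) (slots_hiop D ι c a s P 𝒵 dom Jc V mI L)

end SlotsRecord

/-! ## §5 (v1.1) Run A's insertion-operator table READ AT THE TRANSPORTED BACKGROUND (`ofAt`; F-ne5leaf01g11-1 repair (a′)) -/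

section OfAt

variable {IOp Hist : Type*} [NormedAddCommGroup Hist] [NormedSpace ℂ Hist]

/-- [folklore] **THE `ofAt` LETTERS** (O-8 as intended: «run A's through the transporter exactly as `rawAOfRecord`»): keep every field of `L` but
re-letter run A's insertion-operator table by a table `iopAt` on RUN-A backgrounds, read at `D.carriers.transport U` (typer sketch v0.6 §IOP). -/
def InsLetters.ofAt (L : InsLetters D IOp Hist) (iopAt : ℝ → D.carriers.BgA → ℕ → IOp) : InsLetters D IOp Hist :=
  { L with iopA := fun r U k => iopAt r (D.carriers.transport U) k }

/-- [folklore] `rfl` view: run A's table of the `ofAt` letters is `iopAt` at the transported background. -/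
theorem iopA_ofAt (L : InsLetters D IOp Hist) (iopAt : ℝ → D.carriers.BgA → ℕ → IOp) (r : ℝ) (U : D.carriers.BgB) (k : ℕ) :
    (InsLetters.ofAt D L iopAt).iopA r U k = iopAt r (D.carriers.transport U) k := rfl

/-- [folklore] `rfl` view: run B's table is unchanged. -/
theorem iopB_ofAt (L : InsLetters D IOp Hist) (iopAt : ℝ → D.carriers.BgA → ℕ → IOp) : (InsLetters.ofAt D L iopAt).iopB = L.iopB := rfl

/-- [folklore] D-6′ survives the re-lettering (the same `simp`). -/
theorem lastCouplingOnly_insOpA_ofAt (L : InsLetters D IOp Hist) (iopAt : ℝ → D.carriers.BgA → ℕ → IOp) :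
    LastCouplingOnly (insDatumOfRecord D (InsLetters.ofAt D L iopAt)).insOpA :=
  lastCouplingOnly_insOpA D _

end OfAt

section OfAtSlots

variable {o : Type} [Fintype o] [DecidableEq o] (ι : G →* Matrix o o ℂ) (c : ℂ) (a : ℝ) (s : ℕ → ℂ)
variable {T ι' S Ω 𝒴 : Type} (P : MeasPotFrame D.carriers) {IOp : Type*}
  (𝒵 : D.carriers.Dom → InnerLabel D.carriers.Dom (Bnd D.toTwoRuns) → Type) [∀ Z j, Fintype (𝒵 Z j)] (dom : ∀ Z j, 𝒵 Z j → D.carriers.Dom)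
  (Jc : D.carriers.Dom → InnerLabel D.carriers.Dom (Bnd D.toTwoRuns) → Type) [∀ Z j, Fintype (Jc Z j)]
  (V : D.carriers.Dom → InnerLabel D.carriers.Dom (Bnd D.toTwoRuns) → Type) [∀ Z j, NormedAddCommGroup (V Z j)]
  [∀ Z j, InnerProductSpace ℝ (V Z j)] [∀ Z j, MeasurableSpace (V Z j)] [∀ Z j, BorelSpace (V Z j)] [∀ Z j, FiniteDimensional ℝ (V Z j)]
  (mI : D.carriers.Dom → InnerLabel D.carriers.Dom (Bnd D.toTwoRuns) → Type) [∀ Z j, Fintype (mI Z j)] [∀ Z j, DecidableEq (mI Z j)]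
  (L : SlotLetters D (o := o) (T := T) (ι' := ι') (S := S) (Ω := Ω) (𝒴 := 𝒴) P (IOp := IOp) 𝒵 dom Jc V mI)

/-- [folklore] The slot letters with run A's insertion-operator table re-lettered `ofAt`. -/
def SlotLetters.ofAt (iopAt : ℝ → D.carriers.BgA → ℕ → IOp) :
    SlotLetters D (o := o) (T := T) (ι' := ι') (S := S) (Ω := Ω) (𝒴 := 𝒴) P (IOp := IOp) 𝒵 dom Jc V mI :=
  { L with ins := InsLetters.ofAt D L.ins iopAt }

/-- [folklore] **NE5 L01's READING BY CONSTRUCTION AT THE `ofAt` LETTERS** (F-ne5leaf01g11-1 repair (a′)): for EVERY window `W`,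
`(assembly (slotsOfRecord … (L.ofAt iopAt))).TransportReads W` — O1-e's `B13Represents.Assembly.transportReads_of_insOpAt` BY NAME with `h := rfl`.
(At general `InsLetters` the reading is the displayed factorisation of t4-ne5-formalise-leaf-01's `transportReads_slotsOfRecord_of_factor`,
p221190 — repair (b); both coexist.) -/
theorem transportReads_slotsOfRecord_ofAt (iopAt : ℝ → D.carriers.BgA → ℕ → IOp) (W : Set (ℕ → ℝ)) :
    (B13StepOfRecord.assembly (slotsOfRecord D ι c a s P 𝒵 dom Jc V mI (SlotLetters.ofAt D P 𝒵 dom Jc V mI L iopAt))).TransportReads W :=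
  B13Represents.Assembly.transportReads_of_insOpAt _ (insOpA' := fun g U k => iopAt (g (k - 1)) U k) (fun _ _ _ => rfl) W

end OfAtSlots

end Summit.QuantumFields.BalabanUV.T4Continuum.SubstrateSlotsOfRecord

end
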